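import Literature.Geometry.Lorentzian.NearMinkowskiChart
import Literature.Geometry.Lorentzian.FramedBilinEstimates
import HarnessLib

/-!
# Near-framed chart spacetimes: limit objects of local compactness relative to a framed background

`NearMinkowskiChart.lean` bundles fields `G` with `‖G − η‖ < 1` as spacetimes. Pinching to `η` in the
coordinate frame excludes e.g. the near-horizon region of Kerr–Schild Kerr (`‖g_{M,0} − η‖ = 4M/r`).
Here the pinching is measured in a smooth FRAME FIELD `A` with inverse `A⁻¹` on `O`
(`FrameField O`): the framed field `A⁻¹^* G = framedBilin G A⁻¹` (`FramedBilinEstimates.lean`) is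
required to be `C⁰`-close to `η`. Then `G = A^*(η + h̃)` is Lorentzian (signature is transported
by invertible linear maps), `A⁻¹ ∂₀` is a smooth timelike field, and `(O, G, A⁻¹∂₀)` is a bundled
`Spacetime 4` (`NearFramedChart.spacetime`) whose metric components in its own chart are `G`.
Example of frame: the Kerr–Schild frame `A = I + H ℓ ⊗ ηℓ` with `A^* η = η + 2H ℓ ⊗ ℓ = g_{KS}` and
`A⁻¹ = I − H ℓ ⊗ ηℓ` (`ℓ` null), in which Kerr–Schild metrics are EXACTLY Minkowski and nearby
metrics are pinched down to the horizon and beyond.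

## References
* B. O'Neill, *Semi-Riemannian geometry*, Academic Press 1983, Ch. 5, Lemma 5.26; Ch. 3, p. 58. [ONeill1983]
* P. Petersen, *Riemannian Geometry*, 2nd ed., GTM 171, Springer 2006, Ch. 10, §3.2. [Petersen2006]
-/

noncomputable section

open Set Filter TopologicalSpace Bundle Function
open scoped Manifold ContDiff Topology

namespace Literature.Geometry.Lorentzian

/-! ### Lorentzian signature is transported by invertible linear maps -/

namespace Minkowski

variable {B : E4 →L[ℝ] E4 →L[ℝ] ℝ} {T Tinv : E4 →L[ℝ] E4}

/-- Nondegeneracy is transported: if `B` is nondegenerate and `T` is invertible then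
`(v, w) ↦ B (T v) (T w)` is nondegenerate. [cite: ONeill1983, Ch. 3, p. 58] -/
theorem nondegenerate_comp (hB : ∀ v, (∀ w, B v w = 0) → v = 0)
    (hT : T.comp Tinv = ContinuousLinearMap.id ℝ E4) (hT' : Tinv.comp T = ContinuousLinearMap.id ℝ E4)
    (v : E4) (hv : ∀ w, B (T v) (T w) = 0) : v = 0 := by
  have h1 : T v = 0 := hB (T v) fun w ↦ by
    have := hv (Tinv w)
    rwa [show T (Tinv w) = w from by simpa using DFunLike.congr_fun hT w] at this
  have := DFunLike.congr_fun hT' v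
  simp only [ContinuousLinearMap.coe_comp, comp_apply, h1, map_zero, ContinuousLinearMap.coe_id',
    id_eq] at this
  exact this.symm

/-- Spacelike orthogonal complements are transported. [cite: ONeill1983, Ch. 5, Lemma 5.26] -/
theorem pos_of_orthogonal_comp (hB : ∀ v w, B v v < 0 → B v w = 0 → w ≠ 0 → 0 < B w w)
    (hT' : Tinv.comp T = ContinuousLinearMap.id ℝ E4) (v w : E4) (hv : B (T v) (T v) < 0)
    (hvw : B (T v) (T w) = 0) (hw : w ≠ 0) : 0 < B (T w) (T w) := by
  refine hB (T v) (T w) hv hvw fun h ↦ hw ?_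
  have := DFunLike.congr_fun hT' w
  simp only [ContinuousLinearMap.coe_comp, comp_apply, h, map_zero, ContinuousLinearMap.coe_id',
    id_eq] at this
  exact this.symm

end Minkowski

/-! ### Frame fields -/

/-- A **smooth frame field with smooth inverse** on the open set `O ⊆ E4`. [folklore] -/
structure FrameField (O : Opens E4) where
  /-- The frame `A(y) : E4 →L E4`. -/
  A : E4 → E4 →L[ℝ] E4
  /-- Its pointwise inverse. -/
  Ainv : E4 → E4 →L[ℝ] E4
  contDiffOn_A : ContDiffOn ℝ ∞ A O
  contDiffOn_Ainv : ContDiffOn ℝ ∞ Ainv O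
  comp_Ainv : ∀ y ∈ (O : Set E4), (A y).comp (Ainv y) = ContinuousLinearMap.id ℝ E4
  Ainv_comp : ∀ y ∈ (O : Set E4), (Ainv y).comp (A y) = ContinuousLinearMap.id ℝ E4

namespace FrameField

variable {O : Opens E4} (𝔉 : FrameField O)

/-- **The identity frame** (recovers `NearMinkowskiChart`). [folklore] -/
def identity (O : Opens E4) : FrameField O where
  A _ := ContinuousLinearMap.id ℝ E4
  Ainv _ := ContinuousLinearMap.id ℝ E4
  contDiffOn_A := contDiffOn_const
  contDiffOn_Ainv := contDiffOn_const
  comp_Ainv _ _ := ContinuousLinearMap.comp_id _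
  Ainv_comp _ _ := ContinuousLinearMap.comp_id _

/-- `A (A⁻¹ v) = v` on `O`. [folklore] -/
theorem A_Ainv_apply {y : E4} (hy : y ∈ (O : Set E4)) (v : E4) : 𝔉.A y (𝔉.Ainv y v) = v := by
  simpa using DFunLike.congr_fun (𝔉.comp_Ainv y hy) v

/-- `A⁻¹ (A v) = v` on `O`. [folklore] -/
theorem Ainv_A_apply {y : E4} (hy : y ∈ (O : Set E4)) (v : E4) : 𝔉.Ainv y (𝔉.A y v) = v := by
  simpa using DFunLike.congr_fun (𝔉.Ainv_comp y hy) v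

/-- Unframing with `A` after framing with `A⁻¹`. [folklore] -/
theorem framedBilin_Ainv_A (F : E4 → E4 →L[ℝ] E4 →L[ℝ] ℝ) {y : E4} (hy : y ∈ (O : Set E4)) :
    framedBilin (framedBilin F 𝔉.Ainv) 𝔉.A y = F y :=
  framedBilin_framedBilin_of_comp_eq F (𝔉.Ainv_comp y hy)

/-- Unframing with `A⁻¹` after framing with `A`. [folklore] -/
theorem framedBilin_A_Ainv (F : E4 → E4 →L[ℝ] E4 →L[ℝ] ℝ) {y : E4} (hy : y ∈ (O : Set E4)) :
    framedBilin (framedBilin F 𝔉.A) 𝔉.Ainv y = F y :=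
  framedBilin_framedBilin_of_comp_eq F (𝔉.comp_Ainv y hy)

end FrameField

/-! ### Near-framed fields of bilinear forms -/

/-- **A near-framed chart metric** on `O` relative to the frame field `𝔉`: a field `G` smooth and
symmetric on `O` whose framed field `A⁻¹^* G` is `C⁰`-close to `η` (`‖framedBilin G A⁻¹ (y) − η‖ < 1`).
[cite: ONeill1983, Ch. 5, Lemma 5.26] -/
structure NearFramedChart (O : Opens E4) (𝔉 : FrameField O) where
  /-- The metric components. -/
  G : E4 → E4 →L[ℝ] E4 →L[ℝ] ℝ
  contDiffOn : ContDiffOn ℝ ∞ G O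
  symm : ∀ y ∈ (O : Set E4), ∀ v w : E4, G y v w = G y w v
  norm_framed_sub_lt : ∀ y ∈ (O : Set E4), ‖framedBilin G 𝔉.Ainv y - Minkowski.bilin‖ < 1

namespace NearFramedChart

variable {O : Opens E4} {𝔉 : FrameField O} (L : NearFramedChart O 𝔉)

/-- The framed field as a near-Minkowski chart. [folklore] -/
def framed : NearMinkowskiChart O where
  G := framedBilin L.G 𝔉.Ainv
  contDiffOn := ContDiffOn.framedBilin L.contDiffOn 𝔉.contDiffOn_Ainv
  symm y hy v w := framedBilin_symm 𝔉.Ainv (L.symm y hy) v w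
  norm_sub_lt := L.norm_framed_sub_lt

/-- `G = A^*(framed G)` on `O`. [folklore] -/
theorem G_eq_framedBilin_framed {y : E4} (hy : y ∈ (O : Set E4)) :
    L.G y = framedBilin L.framed.G 𝔉.A y :=
  (𝔉.framedBilin_Ainv_A L.G hy).symm

/-- `G y (v, w) = (framed G)(y)(A v, A w)`. [folklore] -/
theorem G_apply {y : E4} (hy : y ∈ (O : Set E4)) (v w : E4) :
    L.G y v w = L.framed.G y (𝔉.A y v) (𝔉.A y w) := by
  rw [L.G_eq_framedBilin_framed hy]; rfl

/-- `A⁻¹ ∂₀` is timelike: `G(A⁻¹∂₀, A⁻¹∂₀) = (framed G)(∂₀, ∂₀) < 0`. [cite: ONeill1983, Ch. 5, Lemma 5.26] -/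
theorem apply_Ainv_basisVector_zero_neg (y : O) :
    L.G y (𝔉.Ainv y (E4.basisVector 0)) (𝔉.Ainv y (E4.basisVector 0)) < 0 := by
  rw [L.G_apply y.2, 𝔉.A_Ainv_apply y.2]
  exact L.framed.apply_basisVector_zero_neg y

/-- **The Lorentzian metric of a near-framed field** (signature transported from the framed field
through the invertible frame). [cite: ONeill1983, Ch. 5, Lemma 5.26] -/
def metric : LorentzianMetric 𝓘(ℝ, E4) ∞ O where
  val y := L.G y.1
  symm y v w := L.symm y.1 y.2 v w
  nondegenerate y v hv := by
    refine Minkowski.nondegenerate_comp (B := L.framed.G y.1) (T := 𝔉.A y.1) (Tinv := 𝔉.Ainv y.1)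
      (L.framed.metric.nondegenerate y) (𝔉.comp_Ainv y.1 y.2) (𝔉.Ainv_comp y.1 y.2) v fun w ↦ ?_
    have h : L.G y.1 v w = 0 := hv w
    rwa [L.G_apply y.2] at h
  contMDiff y :=
    (OpensChart.contMDiffAt_bilinSection_iff y _ L.G (fun _ ↦ rfl)).2
      ((L.contDiffOn.of_le (by exact_mod_cast le_top)).contDiffAt (O.2.mem_nhds y.2))
  exists_timelike y := ⟨𝔉.Ainv y (E4.basisVector 0), L.apply_Ainv_basisVector_zero_neg y⟩
  pos_of_orthogonal y v w hv hvw hw := by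
    have hv' : L.G y.1 v v < 0 := hv
    have hvw' : L.G y.1 v w = 0 := hvw
    rw [L.G_apply y.2] at hv' hvw'
    show 0 < L.G y.1 w w
    rw [L.G_apply y.2]
    exact Minkowski.pos_of_orthogonal_comp (B := L.framed.G y.1) (T := 𝔉.A y.1) (Tinv := 𝔉.Ainv y.1)
      (L.framed.metric.pos_of_orthogonal y) (𝔉.Ainv_comp y.1 y.2) v w hv' hvw' hw

/-- **Time orientation by `A⁻¹ ∂₀`** (smooth: `A⁻¹` is smooth on `O`). [cite: ONeill1983, Ch. 5, p. 145] -/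
def timeOrientation : TimeOrientation L.metric where
  vectorField y := (𝔉.Ainv y.1 (E4.basisVector 0) : E4)
  isTimelike y := L.apply_Ainv_basisVector_zero_neg y
  contMDiff x := by
    rw [OpensChart.contMDiffAt_section_iff]
    have h : ContDiffAt ℝ ∞ (fun y : E4 ↦ 𝔉.Ainv y (E4.basisVector 0)) x :=
      ((𝔉.contDiffOn_Ainv.contDiffAt (O.2.mem_nhds x.2)).clm_apply contDiffAt_const)
    exact (OpensChart.contMDiffAt_iff x _ (fun y : E4 ↦ 𝔉.Ainv y (E4.basisVector 0))
      (fun _ ↦ rfl)).2 h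

/-- The orienting field is `A⁻¹ ∂₀`. [folklore] -/
@[simp]
theorem timeOrientation_vectorField (y : O) :
    L.timeOrientation.vectorField y = (𝔉.Ainv y.1 (E4.basisVector 0) : E4) := rfl

/-- **The near-framed chart spacetime** `(O, G, A⁻¹∂₀)` for connected `O`. [cite: Petersen2006, Ch. 10 §3.2] -/
def spacetime (hO : IsConnected (O : Set E4)) : Spacetime 4 :=
  letI : ConnectedSpace O := isConnected_iff_connectedSpace.mp hO
  { carrier := O
    metric := L.metric
    timeOrientation := L.timeOrientation }

variable (hO : IsConnected (O : Set E4))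

/-- Its orienting field is `A⁻¹ ∂₀`. [folklore] -/
@[simp]
theorem spacetime_vectorField (y : O) :
    (L.spacetime hO).timeOrientation.vectorField y = (𝔉.Ainv y.1 (E4.basisVector 0) : E4) := rfl

/-- **The metric components of the near-framed chart spacetime in its own (inclusion) charts
agree with `G` on `O`** (the metric of `L.spacetime` at `y` is `G y` by construction and the inverse
chart has identity differential). [cite: Petersen2006, Ch. 10 §3.2] -/
theorem metricInCoords_chartAt_symm_eqOn (x : O) :
    EqOn ((L.spacetime hO).metricInCoords (chartAt E4 x).symm) L.G (O : Set E4) := by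
  intro y hy
  set ψ : E4 → (L.spacetime hO).carrier := fun z ↦ (chartAt E4 x).symm z with hψ
  have hd : ∀ u : E4, mfderiv 𝓘(ℝ, E4) (𝓡 4) ψ y u = u := fun u ↦ by
    have h := OpensChart.mfderiv_extChartAt_symm_apply x hy u
    rw [OpensChart.extChartAt_eq] at h
    exact h
  have hval : (ψ y).1 = y := OpensChart.chartAt_symm_val x hy
  ext v w
  rw [Spacetime.metricInCoords_apply, hd v, hd w]
  change L.G (ψ y).1 v w = L.G y v w
  rw [hval]

end NearFramedChart

end Literature.Geometry.Lorentzian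

end
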